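import Summits.BirchSwinnertonDyer.BirchSwinnertonDyer.Theorems.BiquadraticEisensteinDescentHeegnerTwistCouplingInSupplyQuarticTwistDescent
import Literature.NumberTheory.EllipticCurves.XCubeAddDXSharpRankSha
import HarnessLib

set_option linter.dupNamespace false -- `Summit.BirchSwinnertonDyer.BirchSwinnertonDyer.Theorems.…` (summit = sub)
set_option autoImplicit false

/-!
# Crux `HeegnerTwistCouplingInSupply` (stmt-BirchSwinnertonDyer-21381) — the QUARTIC `j = 1728` corner, II:
# the dual side `S(0, 100pq²) = {1, p}`, hence `rank = 0`, `Ш[2] = 0`, `corank_{ℤ₂} Sel_{2^∞} = 0` for `y² = x³ − 25pq²·x`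

Route `BiquadraticEisensteinDescent` (cell `pub/bsd-wall`, width seat `bsd-wall-cm-bed-w4` g13; `--supports` 21381, helper;
LEAD-VERDICT-ibd-p1-g11 §4 (ii) «other `j = 1728` curves»). Continuation of `…QuarticTwistDescent` (`S(0, −25pq²) = {1, −p}`):
for primes `p ≡ 7 (mod 8)`, `p ≡ 4 (mod 5)`, `q ≡ 3 (mod 8)` with `(q/p) = −1`, the descent on the divisors of `b′ = 100pq²`
(Silverman AEC X.4.9: `S^{(φ)}(E/ℚ)` for `E : y² = x³ − 25pq²x`, `E′ : y² = x³ + 100pq²x`) gives ★ `mem_selmer_pos_iff`: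
`S(0, 100pq²) = {1, p}`. Of the thirty-two squarefree divisors the sixteen negative ones die over `ℝ`; `1`, `p` are the images
of `O`, `T`; `q, pq, 5q, 5pq, 2q, 2pq, 10q, 10pq` die at `p`; `2, 2p` die at `5` (`2`, `2pq²`, `2p`, `2q²` non-residues mod `5`);
`5, 5p` die at `5` and `10, 10p` at `q` when `q ≡ ±1 (mod 5)`, the other way round when `q ≡ ±2 (mod 5)` — here quadratic
reciprocity enters: `(p/q) = −(q/p) = +1`.

Consequences (§3, Silverman X.4.7 with X.4.2(a) as counted in the tree's `natCard_sha_inf_range_eq_one_of_selmerRank_add_le`):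
`dim₂ S + dim₂ S′ = 2 = rank + 2 − dim Ш-parts`, so ★ `mordellWeilRank_twist_eq_zero`, `forall_mem_sha_two_smul_eq_zero_twist`
(`Ш[2] = 0`) and ★ `selmerCorank_two_twist_eq_zero` (`corank_{ℤ₂} Sel_{2^∞}(E/ℚ) = 0`, Greenberg's identity) for
`E = ⟨0, 0, 0, −25pq², 0⟩` — UNCONDITIONAL. The corner theorem (Heegner field, `L`-value via Burungale–Tian) is in
`…QuarticTwistCorner`. Validated numerically beforehand (BSD Lemmas 6/7, 132/132 pairs).

HONEST FRAMING: a typed sub-corner on one CM family (measure zero in «all CM `W`»); the crux (residual C⁺) is untouched;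
BSD is not proved by any of this. THEOREMS ONLY (no `def`, no named fact, no sorry). Supports stmt-BirchSwinnertonDyer-21381.
-/

noncomputable section

open scoped Classical

namespace Summit.BirchSwinnertonDyer.BirchSwinnertonDyer.Theorems.BiquadraticEisensteinDescentHeegnerTwistCouplingInSupplyQuarticTwistDescentDual

open Literature.NumberTheory.EllipticCurves Literature.NumberTheory.EllipticCurves.XCubeAddPX
  Summit.BirchSwinnertonDyer.BirchSwinnertonDyer.Theorems.BiquadraticEisensteinDescentHeegnerTwistCouplingInSupplyQuarticTwistLocal
  Summit.BirchSwinnertonDyer.BirchSwinnertonDyer.Theorems.BiquadraticEisensteinDescentHeegnerTwistCouplingInSupplyQuarticTwistDescent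
  _root_.WeierstrassCurve

/-! ## §1 Residues modulo `q` (`q ≡ 3 (mod 8)`, `(p/q) = +1` by reciprocity) and modulo `5` -/

section Residues

variable {p q : ℕ} [hp : Fact p.Prime] [hq : Fact q.Prime]

/-- **Quadratic reciprocity step**: for primes `p ≡ q ≡ 3 (mod 4)`, `q` a non-residue mod `p` ⟹ `p` a residue mod `q`. [folklore] -/
theorem isSquare_p_mod_q (hp4 : p % 4 = 3) (hq4 : q % 4 = 3) (hnq : ¬ IsSquare ((q : ℤ) : ZMod p)) :
    IsSquare ((p : ℤ) : ZMod q) := by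
  have hpq : p ≠ q := by rintro rfl; exact hnq ⟨0, by simp⟩
  have hl : legendreSym p q = -1 := legendreSym.eq_neg_one_iff p |>.mpr hnq
  have hrec := legendreSym.quadratic_reciprocity_three_mod_four hp4 hq4
  have h1 : legendreSym q p = 1 := by rw [hrec, hl]; norm_num
  have hp0 : ((p : ℤ) : ZMod q) ≠ 0 := by
    intro h0
    have : (q : ℤ) ∣ p := (ZMod.intCast_zmod_eq_zero_iff_dvd p q).mp h0
    have : q ∣ p := by exact_mod_cast this
    exact hpq (((Nat.prime_dvd_prime_iff_eq hq.out hp.out).mp this).symm)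
  exact (legendreSym.eq_one_iff q hp0).mp h1

omit hp in
/-- `2` is a non-residue mod `q ≡ 3 (mod 8)`. [folklore] -/
theorem not_isSquare_two_mod_q (hq8 : q % 8 = 3) : ¬ IsSquare ((2 : ℤ) : ZMod q) := by
  push_cast
  rw [ZMod.exists_sq_eq_two_iff (by rintro rfl; omega)]
  omega

omit hp in
/-- `(5/q) = (q/5)`: `5` is a residue mod `q` iff `q ≡ ±1 (mod 5)` (`q ≠ 2, 5`). [folklore] -/
theorem legendreSym_five_eq (hq2 : q ≠ 2) :
    legendreSym q 5 = @legendreSym 5 ⟨Nat.prime_five⟩ ((q : ℤ) % 5) := by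
  haveI : Fact (Nat.Prime 5) := ⟨Nat.prime_five⟩
  have h := legendreSym.quadratic_reciprocity_one_mod_four (p := 5) (q := q) (by norm_num) hq2
  have h5 : ((5 : ℕ) : ℤ) = 5 := by norm_num
  rw [h5] at h
  rw [h]
  exact legendreSym.mod 5 (q : ℤ)

omit hp in
/-- `5` is a residue mod `q` for `q ≡ ±1 (mod 5)`. [folklore] -/
theorem isSquare_five_mod_q (hq2 : q ≠ 2) (h : q % 5 = 1 ∨ q % 5 = 4) : IsSquare ((5 : ℤ) : ZMod q) := by
  haveI : Fact (Nat.Prime 5) := ⟨Nat.prime_five⟩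
  have h5 : ((5 : ℤ) : ZMod q) ≠ 0 := by
    intro h0
    have : (q : ℤ) ∣ 5 := (ZMod.intCast_zmod_eq_zero_iff_dvd 5 q).mp h0
    have h' : q ∣ 5 := by exact_mod_cast this
    rcases (Nat.dvd_prime Nat.prime_five).mp h' with h'' | h'' <;> [exact hq.out.one_lt.ne' h''; omega]
  rw [← legendreSym.eq_one_iff q h5, legendreSym_five_eq hq2]
  have : (q : ℤ) % 5 = 1 ∨ (q : ℤ) % 5 = 4 := by omega
  rcases this with h | h <;> rw [h] <;> norm_num

omit hp in
/-- `5` is a non-residue mod `q` for `q ≡ ±2 (mod 5)`. [folklore] -/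
theorem not_isSquare_five_mod_q (hq2 : q ≠ 2) (h : q % 5 = 2 ∨ q % 5 = 3) : ¬ IsSquare ((5 : ℤ) : ZMod q) := by
  haveI : Fact (Nat.Prime 5) := ⟨Nat.prime_five⟩
  rw [← legendreSym.eq_neg_one_iff q, legendreSym_five_eq hq2]
  have : (q : ℤ) % 5 = 2 ∨ (q : ℤ) % 5 = 3 := by omega
  rcases this with h | h <;> rw [h] <;> norm_num

/-- In a field: product of two squares is a square (helper in the cast shapes used below). [folklore] -/
theorem isSquare_mul' {F : Type*} [Field F] {a b : F} (ha : IsSquare a) (hb : IsSquare b) : IsSquare (a * b) :=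
  ha.mul hb

/-- `(n : ZMod 5)² = 1` for `n ≡ ±1 (mod 5)`. [folklore] -/
theorem natCast_sq_zmod5_eq_one {n : ℕ} (h : n % 5 = 1 ∨ n % 5 = 4) : (n : ZMod 5) ^ 2 = 1 := by
  rw [← ZMod.natCast_mod n 5]
  rcases h with h | h <;> rw [h] <;> decide

/-- `(n : ZMod 5)² = 4` for `n ≡ ±2 (mod 5)`. [folklore] -/
theorem natCast_sq_zmod5_eq_four {n : ℕ} (h : n % 5 = 2 ∨ n % 5 = 3) : (n : ZMod 5) ^ 2 = 4 := by
  rw [← ZMod.natCast_mod n 5]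
  rcases h with h | h <;> rw [h] <;> decide

/-- `(n : ZMod 5) ≠ 0` for `5 ∤ n`. [folklore] -/
theorem natCast_zmod5_ne_zero {n : ℕ} (h : n % 5 ≠ 0) : (n : ZMod 5) ≠ 0 := by
  rw [Ne, ZMod.natCast_eq_zero_iff]
  exact fun hd => h (Nat.eq_zero_of_dvd_of_lt ((Nat.dvd_mod_iff (dvd_refl 5)).mpr hd) (Nat.mod_lt n (by norm_num)))

/-- Non-residues modulo `5` met below: `2`, `2·4`, `2·4·a²`, `2·a²` (`a ≠ 0`). [folklore] -/
theorem not_isSquare_zmod5 :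
    ¬ IsSquare (2 : ZMod 5) ∧ ¬ IsSquare (2 * 4 : ZMod 5) ∧
      (∀ a : ZMod 5, a ≠ 0 → ¬ IsSquare (2 * 4 * a ^ 2)) ∧ (∀ a : ZMod 5, a ≠ 0 → ¬ IsSquare (2 * a ^ 2)) := by
  refine ⟨by decide, by decide, by decide, by decide⟩

/-- The four reduced forms met at `5` are anisotropic (`x⁴ ∈ {0,1}` mod `5`): classes `5, 5p` for `a² = 1` and `10, 10p` for
`a² = 4`, `a = q mod 5`, `p ≡ 4`. [folklore] -/
theorem anisotropic_mod_five_cases :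
    (∀ a : ZMod 5, a ^ 2 = 1 → ∀ x y : ZMod 5, 1 * x ^ 4 + 4 * 4 * a ^ 2 * y ^ 4 = 0 → x = 0 ∧ y = 0) ∧
    (∀ a : ZMod 5, a ^ 2 = 1 → ∀ x y : ZMod 5, 4 * x ^ 4 + 4 * a ^ 2 * y ^ 4 = 0 → x = 0 ∧ y = 0) ∧
    (∀ a : ZMod 5, a ^ 2 = 4 → ∀ x y : ZMod 5, 2 * x ^ 4 + 2 * 4 * a ^ 2 * y ^ 4 = 0 → x = 0 ∧ y = 0) ∧
    (∀ a : ZMod 5, a ^ 2 = 4 → ∀ x y : ZMod 5, 2 * 4 * x ^ 4 + 2 * a ^ 2 * y ^ 4 = 0 → x = 0 ∧ y = 0) := by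
  refine ⟨by decide, by decide, by decide, by decide⟩

end Residues

/-! ## §2 The side `S(0, 100pq²)`: local kills and `S = {1, p}` -/

section Dual

variable {p q : ℕ} [hp : Fact p.Prime] [hq : Fact q.Prime]

/-- The squarefree divisors of `100·p·q²`: absolute values among `{1,2,5,10}·{1,p}·{1,q}`. [folklore] -/
theorem natAbs_eq_of_squarefree_dvd' {d : ℤ} (hsq : Squarefree d) (hdvd : d ∣ (100 * p * q ^ 2 : ℤ)) :
    (d.natAbs = 1 ∨ d.natAbs = 2 ∨ d.natAbs = 5 ∨ d.natAbs = 2 * 5) ∨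
    (d.natAbs = p ∨ d.natAbs = 2 * p ∨ d.natAbs = 5 * p ∨ d.natAbs = 2 * 5 * p) ∨
    (d.natAbs = q ∨ d.natAbs = 2 * q ∨ d.natAbs = 5 * q ∨ d.natAbs = 2 * 5 * q) ∨
    (d.natAbs = p * q ∨ d.natAbs = 2 * (p * q) ∨ d.natAbs = 5 * (p * q) ∨ d.natAbs = 2 * 5 * (p * q)) := by
  set m := d.natAbs with hm_def
  have hmsq : Squarefree m := Int.squarefree_natAbs.mpr hsq
  have hm1 : m ∣ 100 * p * q ^ 2 := by
    have h1 := Int.natAbs_dvd_natAbs.mpr hdvd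
    have h2 : (100 * p * q ^ 2 : ℤ).natAbs = 100 * p * q ^ 2 := by
      rw [show (100 * p * q ^ 2 : ℤ) = ((100 * p * q ^ 2 : ℕ) : ℤ) by push_cast; ring, Int.natAbs_natCast]
    rwa [h2] at h1
  have hm2 : m ∣ (2 * 5 * (p * q)) ^ 2 := dvd_trans hm1 ⟨p, by ring⟩
  have hm3 : m ∣ 2 * 5 * (p * q) := (hmsq.dvd_pow_iff_dvd two_ne_zero).mp hm2
  obtain ⟨a, b, ha, hb, hm⟩ := exists_dvd_and_dvd_of_dvd_mul hm3
  obtain ⟨a₁, a₂, ha₁, ha₂, rfl⟩ := exists_dvd_and_dvd_of_dvd_mul ha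
  obtain ⟨b₁, b₂, hb₁, hb₂, rfl⟩ := exists_dvd_and_dvd_of_dvd_mul hb
  rcases (Nat.dvd_prime Nat.prime_two).mp ha₁ with h1 | h1 <;>
  rcases (Nat.dvd_prime Nat.prime_five).mp ha₂ with h2 | h2 <;>
  rcases (Nat.dvd_prime hp.out).mp hb₁ with h3 | h3 <;>
  rcases (Nat.dvd_prime hq.out).mp hb₂ with h4 | h4 <;>
  · rw [hm, h1, h2, h3, h4]; simp

/-- ★ **`S(0, 100pq²) = {1, p}`** for primes `p ≡ 7 (mod 8)`, `p ≡ 4 (mod 5)`, `q ≡ 3 (mod 8)` with `q` a non-residue mod `p`: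
descent on the divisors of `b′ = 100pq²` for the twist `W_p⁻^{(−5q)} : y² = x³ − 25pq²·x` (Silverman's `S^{(φ)}(E/ℚ)`).
[cite: SilvermanAEC2009, Prop. X.4.9 and Prop. X.6.1] -/
theorem mem_selmer_pos_iff (hp8 : p % 8 = 7) (hp5 : p % 5 = 4) (hq8 : q % 8 = 3)
    (hnq : ¬ IsSquare ((q : ℤ) : ZMod p)) (d : ℤ) :
    d ∈ twoIsogenySelmerGroup 0 (100 * p * q ^ 2 : ℤ) ↔ d = 1 ∨ d = (p : ℤ) := by
  have hP := hp.out
  have hQ := hq.out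
  have hqp : q ≠ p := by rintro rfl; omega
  have hp0 : (p : ℤ) ≠ 0 := by exact_mod_cast hP.ne_zero
  have hq0 : (q : ℤ) ≠ 0 := by exact_mod_cast hQ.ne_zero
  have hbpos : (0 : ℤ) < 100 * p * q ^ 2 := by positivity
  have hb : (100 * p * q ^ 2 : ℤ) ≠ 0 := hbpos.ne'
  have hpq : ¬ (p : ℤ) ∣ q := fun h => hqp (((Nat.prime_dvd_prime_iff_eq hP hQ).mp (by exact_mod_cast h))).symm
  have hp5' : ¬ (p : ℤ) ∣ 5 := fun h => by
    have h' : p ∣ 5 := by exact_mod_cast h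
    rcases (Nat.dvd_prime Nat.prime_five).mp h' with h'' | h'' <;> omega
  have hp2' : ¬ (p : ℤ) ∣ 2 := fun h => by
    have h' : p ∣ 2 := by exact_mod_cast h
    rcases (Nat.dvd_prime Nat.prime_two).mp h' with h'' | h'' <;> omega
  have hpI : Prime (p : ℤ) := Nat.prime_iff_prime_int.mp hP
  have hnd : ∀ m : ℤ, ¬ (p : ℤ) ∣ m → ¬ (p : ℤ) ^ 2 ∣ (p : ℤ) * m := fun m hm => not_sq_dvd_mul_of_not_dvd hm
  -- `p ∤ 100q, 20q, 50q, 10q`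
  have hnd' : ∀ k : ℤ, k = 100 ∨ k = 20 ∨ k = 50 ∨ k = 10 → ¬ (p : ℤ) ∣ k * q := by
    intro k hk h
    rcases hpI.dvd_or_dvd h with h | h
    · rcases hk with rfl | rfl | rfl | rfl
      · exact hp5' (hpI.dvd_of_dvd_pow (show (p : ℤ) ∣ 5 ^ 2 from
          (hpI.dvd_or_dvd (show (p : ℤ) ∣ 2 ^ 2 * 5 ^ 2 by norm_num at h ⊢; exact h)).resolve_left
            (fun h4 => hp2' (hpI.dvd_of_dvd_pow h4))))
      · exact hp5' ((hpI.dvd_or_dvd (show (p : ℤ) ∣ 2 ^ 2 * 5 by norm_num at h ⊢; exact h)).resolve_left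
          (fun h4 => hp2' (hpI.dvd_of_dvd_pow h4)))
      · exact hp2' ((hpI.dvd_or_dvd (show (p : ℤ) ∣ 2 * 5 ^ 2 by norm_num at h ⊢; exact h)).resolve_right
          (fun h4 => hp5' (hpI.dvd_of_dvd_pow h4)))
      · exact hp2' ((hpI.dvd_or_dvd (show (p : ℤ) ∣ 2 * 5 by norm_num at h ⊢; exact h)).resolve_right hp5')
    · exact hpq h
  obtain ⟨-, -, h5q, -, -, -, h2q, h50q, h20q, h100q⟩ := nonresidues_mod_p hp8 hp5 hQ hqp hnq
  have h2 := isSquare_two (p := p) hp8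
  have h5 := isSquare_five (p := p) (by rintro rfl; omega) (Or.inr hp5)
  have h20 : ((2 : ℤ) : ZMod p) ≠ 0 := by
    intro h0
    exact hp2' ((ZMod.intCast_zmod_eq_zero_iff_dvd 2 p).mp h0)
  have h50 : ((5 : ℤ) : ZMod p) ≠ 0 := by
    intro h0
    exact hp5' ((ZMod.intCast_zmod_eq_zero_iff_dvd 5 p).mp h0)
  have h10q : ¬ IsSquare (((2 * 5 * q : ℤ)) : ZMod p) := by
    rw [show ((2 * 5 * q : ℤ) : ZMod p) = ((2 * q : ℤ) : ZMod p) * ((5 : ℤ) : ZMod p) by push_cast; ring]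
    exact not_isSquare_mul_of_isSquare h2q h5 h50
  -- residues mod `q`
  have hpmq := isSquare_p_mod_q (p := p) (q := q) (by omega) (by omega) hnq
  have h2mq := not_isSquare_two_mod_q (q := q) hq8
  have hpq0 : ((p : ℤ) : ZMod q) ≠ 0 := by
    intro h0
    have : (q : ℤ) ∣ p := (ZMod.intCast_zmod_eq_zero_iff_dvd p q).mp h0
    have : q ∣ p := by exact_mod_cast this
    exact hqp ((Nat.prime_dvd_prime_iff_eq hQ hP).mp this)
  have h4mq : IsSquare ((4 : ℤ) : ZMod q) := ⟨2, by push_cast; norm_num⟩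
  -- residues mod `5`
  haveI : Fact (Nat.Prime 2) := ⟨Nat.prime_two⟩
  haveI i5 : Fact (Nat.Prime 5) := ⟨Nat.prime_five⟩
  have hp' : (p : ZMod 5) = 4 := by simpa using natCast_zmod5_of_mod hp5 (by norm_num)
  have hq5 : q % 5 ≠ 0 := fun h => by
    rcases (Nat.dvd_prime hQ).mp (Nat.dvd_of_mod_eq_zero h) with h' | h' <;> omega
  have hq2 : q ≠ 2 := by rintro rfl; omega
  have hq05 : (q : ZMod 5) ≠ 0 := natCast_zmod5_ne_zero hq5
  have hq14 : (q % 5 = 1 ∨ q % 5 = 4) ∨ (q % 5 = 2 ∨ q % 5 = 3) := by omega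
  obtain ⟨n2, n8, n2pq, n2q⟩ := not_isSquare_zmod5
  obtain ⟨a5, a5p, a10, a10p⟩ := anisotropic_mod_five_cases
  have h5q0 : ((5 : ℤ) : ZMod q) ≠ 0 := by
    intro h0
    have : (q : ℤ) ∣ 5 := (ZMod.intCast_zmod_eq_zero_iff_dvd 5 q).mp h0
    have h' : q ∣ 5 := by exact_mod_cast this
    rcases (Nat.dvd_prime Nat.prime_five).mp h' with h'' | h'' <;> omega
  have h4q0 : ((4 : ℤ) : ZMod q) ≠ 0 := by
    intro h0
    have : (q : ℤ) ∣ 4 := (ZMod.intCast_zmod_eq_zero_iff_dvd 4 q).mp h0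
    have h' : q ∣ 2 ^ 2 := by exact_mod_cast this
    exact hq2 ((Nat.prime_dvd_prime_iff_eq hQ Nat.prime_two).mp (hQ.dvd_of_dvd_pow h'))
  constructor
  · intro hd
    have hsq := squarefree_of_mem_twoIsogenySelmerGroup hd
    have hd0 : d ≠ 0 := hsq.ne_zero
    have hdvd : d ∣ (100 * p * q ^ 2 : ℤ) := dvd_of_mem_twoIsogenySelmerGroup hd
    have key : ∀ d' : ℤ, d * d' = (100 * p * q ^ 2 : ℤ) → (twoIsogenyQuartic 0 d d').IsLocallySoluble :=
      fun d' hdd => isLocallySoluble_of_mem hd0 hdd hd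
    -- negative classes die over `ℝ`
    rcases lt_or_gt_of_ne hd0 with hneg | hpos
    · exfalso
      obtain ⟨d', hd'⟩ := hdvd
      have hd'neg : d' < 0 := by
        rcases pos_and_pos_or_neg_and_neg_of_mul_pos (show 0 < d * d' by rw [← hd']; exact hbpos) with ⟨h1, -⟩ | ⟨-, h2⟩
        · exact absurd h1 (not_lt.mpr hneg.le)
        · exact h2
      exact not_isSoluble_real_twoIsogenyQuartic_of_neg hneg hd'neg le_rfl (key d' hd'.symm).1
    have hdabs : d = (d.natAbs : ℤ) := (Int.natAbs_of_nonneg hpos.le).symm ▸ rfl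
    rcases natAbs_eq_of_squarefree_dvd' (p := p) (q := q) hsq hdvd with (h | h | h | h) | (h | h | h | h) | (h | h | h | h) |
        (h | h | h | h) <;> rw [h] at hdabs <;> push_cast at hdabs <;> subst hdabs
    · exact Or.inl rfl
    · -- d = 2 : dies at 5 (`2`, `2·4·q²` non-residues mod 5)
      refine absurd ((key (50 * p * q ^ 2) (by ring)).2 5) ?_
      refine not_isSoluble_padic_of_sq_mul (ℓ := 5) (c := 2) (c' := 50 * p * q ^ 2) (c'' := 2 * p * q ^ 2)
        (by push_cast; ring) (by push_cast; exact n2) ?_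
      push_cast; rw [hp']
      exact n2pq _ hq05
    · -- d = 5 : dies at 5 if q ≡ ±1 (5), at q if q ≡ ±2 (5)
      rcases hq14 with hq1 | hq2'
      · refine absurd ((key (20 * p * q ^ 2) (by ring)).2 5) ?_
        refine not_isSoluble_padic_of_dvd_of_dvd (ℓ := 5) (c := 5) (c' := 20 * p * q ^ 2) (c₀ := 1)
          (c₀' := 4 * p * q ^ 2) (by norm_num) (by push_cast; ring) ?_
        push_cast; rw [hp']
        exact a5 _ (natCast_sq_zmod5_eq_one hq1)
      · refine absurd ((key (20 * p * q ^ 2) (by ring)).2 q) ?_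
        refine not_isSoluble_padic_of_sq_mul (ℓ := q) (c := 5) (c' := 20 * p * q ^ 2) (c'' := 20 * p)
          (by ring) (not_isSquare_five_mod_q hq2 hq2') ?_
        rw [show ((20 * p : ℤ) : ZMod q) = ((5 : ℤ) : ZMod q) * (((4 : ℤ) : ZMod q) * ((p : ℤ) : ZMod q)) by push_cast; ring]
        exact not_isSquare_mul_of_isSquare (not_isSquare_five_mod_q hq2 hq2') (isSquare_mul' h4mq hpmq)
          (mul_ne_zero h4q0 hpq0)
    · -- d = 10 : dies at q if q ≡ ±1 (5), at 5 if q ≡ ±2 (5)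
      rcases hq14 with hq1 | hq2'
      · refine absurd ((key (10 * p * q ^ 2) (by ring)).2 q) ?_
        refine not_isSoluble_padic_of_sq_mul (ℓ := q) (c := 2 * 5) (c' := 10 * p * q ^ 2) (c'' := 10 * p)
          (by ring) ?_ ?_
        · rw [show ((2 * 5 : ℤ) : ZMod q) = ((2 : ℤ) : ZMod q) * ((5 : ℤ) : ZMod q) by push_cast; ring]
          exact not_isSquare_mul_of_isSquare h2mq (isSquare_five_mod_q hq2 hq1) h5q0
        · rw [show ((10 * p : ℤ) : ZMod q) = ((2 : ℤ) : ZMod q) * (((5 : ℤ) : ZMod q) * ((p : ℤ) : ZMod q)) by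
            push_cast; ring]
          exact not_isSquare_mul_of_isSquare h2mq (isSquare_mul' (isSquare_five_mod_q hq2 hq1) hpmq)
            (mul_ne_zero h5q0 hpq0)
      · refine absurd ((key (10 * p * q ^ 2) (by ring)).2 5) ?_
        refine not_isSoluble_padic_of_dvd_of_dvd (ℓ := 5) (c := 2 * 5) (c' := 10 * p * q ^ 2) (c₀ := 2)
          (c₀' := 2 * p * q ^ 2) (by norm_num) (by push_cast; ring) ?_
        push_cast; rw [hp']
        exact a10 _ (natCast_sq_zmod5_eq_four hq2')
    · exact Or.inr rfl
    · -- d = 2p : dies at 5 (`2·4`, `2q²` non-residues)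
      refine absurd ((key (50 * q ^ 2) (by ring)).2 5) ?_
      refine not_isSoluble_padic_of_sq_mul (ℓ := 5) (c := 2 * (p : ℤ)) (c' := 50 * q ^ 2) (c'' := 2 * q ^ 2)
        (by push_cast; ring) (by push_cast; rw [hp']; exact n8) ?_
      push_cast
      exact n2q _ hq05
    · -- d = 5p
      rcases hq14 with hq1 | hq2'
      · refine absurd ((key (20 * q ^ 2) (by ring)).2 5) ?_
        refine not_isSoluble_padic_of_dvd_of_dvd (ℓ := 5) (c := 5 * (p : ℤ)) (c' := 20 * q ^ 2) (c₀ := (p : ℤ))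
          (c₀' := 4 * q ^ 2) (by push_cast; ring) (by push_cast; ring) ?_
        push_cast; rw [hp']
        exact a5p _ (natCast_sq_zmod5_eq_one hq1)
      · refine absurd ((key (20 * q ^ 2) (by ring)).2 q) ?_
        refine not_isSoluble_padic_of_sq_mul (ℓ := q) (c := 5 * (p : ℤ)) (c' := 20 * q ^ 2) (c'' := 20)
          (by ring) ?_ ?_
        · rw [show ((5 * p : ℤ) : ZMod q) = ((5 : ℤ) : ZMod q) * ((p : ℤ) : ZMod q) by push_cast; ring]
          exact not_isSquare_mul_of_isSquare (not_isSquare_five_mod_q hq2 hq2') hpmq hpq0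
        · rw [show ((20 : ℤ) : ZMod q) = ((5 : ℤ) : ZMod q) * ((4 : ℤ) : ZMod q) by push_cast; ring]
          exact not_isSquare_mul_of_isSquare (not_isSquare_five_mod_q hq2 hq2') h4mq h4q0
    · -- d = 10p
      rcases hq14 with hq1 | hq2'
      · refine absurd ((key (10 * q ^ 2) (by ring)).2 q) ?_
        refine not_isSoluble_padic_of_sq_mul (ℓ := q) (c := 2 * 5 * (p : ℤ)) (c' := 10 * q ^ 2) (c'' := 10)
          (by ring) ?_ ?_
        · rw [show ((2 * 5 * p : ℤ) : ZMod q) = ((2 : ℤ) : ZMod q) * (((5 : ℤ) : ZMod q) * ((p : ℤ) : ZMod q)) by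
            push_cast; ring]
          exact not_isSquare_mul_of_isSquare h2mq (isSquare_mul' (isSquare_five_mod_q hq2 hq1) hpmq)
            (mul_ne_zero h5q0 hpq0)
        · rw [show ((10 : ℤ) : ZMod q) = ((2 : ℤ) : ZMod q) * ((5 : ℤ) : ZMod q) by push_cast; ring]
          exact not_isSquare_mul_of_isSquare h2mq (isSquare_five_mod_q hq2 hq1) h5q0
      · refine absurd ((key (10 * q ^ 2) (by ring)).2 5) ?_
        refine not_isSoluble_padic_of_dvd_of_dvd (ℓ := 5) (c := 2 * 5 * (p : ℤ)) (c' := 10 * q ^ 2) (c₀ := 2 * (p : ℤ))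
          (c₀' := 2 * q ^ 2) (by push_cast; ring) (by push_cast; ring) ?_
        push_cast; rw [hp']
        exact a10p _ (natCast_sq_zmod5_eq_four hq2')
    · -- d = q : dies at p
      refine absurd ((key (100 * p * q) (by ring)).2 p) ?_
      exact not_isSoluble_padic_of_dvd_right (c := (q : ℤ)) (c' := 100 * p * q) ⟨100 * q, by ring⟩
        (by rw [show (100 * p * q : ℤ) = p * (100 * q) by ring]; exact hnd _ (hnd' 100 (Or.inl rfl))) hnq
    · -- d = 2q : dies at p
      refine absurd ((key (50 * p * q) (by ring)).2 p) ?_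
      exact not_isSoluble_padic_of_dvd_right (c := 2 * (q : ℤ)) (c' := 50 * p * q) ⟨50 * q, by ring⟩
        (by rw [show (50 * p * q : ℤ) = p * (50 * q) by ring]; exact hnd _ (hnd' 50 (Or.inr (Or.inr (Or.inl rfl))))) h2q
    · -- d = 5q : dies at p
      refine absurd ((key (20 * p * q) (by ring)).2 p) ?_
      exact not_isSoluble_padic_of_dvd_right (c := 5 * (q : ℤ)) (c' := 20 * p * q) ⟨20 * q, by ring⟩
        (by rw [show (20 * p * q : ℤ) = p * (20 * q) by ring]; exact hnd _ (hnd' 20 (Or.inr (Or.inl rfl)))) h5q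
    · -- d = 10q : dies at p
      refine absurd ((key (10 * p * q) (by ring)).2 p) ?_
      exact not_isSoluble_padic_of_dvd_right (c := 2 * 5 * (q : ℤ)) (c' := 10 * p * q) ⟨10 * q, by ring⟩
        (by rw [show (10 * p * q : ℤ) = p * (10 * q) by ring]; exact hnd _ (hnd' 10 (Or.inr (Or.inr (Or.inr rfl))))) h10q
    · -- d = pq : dies at p
      refine absurd ((key (100 * q) (by ring)).2 p) ?_
      exact not_isSoluble_padic_of_dvd_left (c := (p : ℤ) * q) (c' := 100 * q) ⟨q, by ring⟩ (hnd _ hpq) h100q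
    · -- d = 2pq : dies at p
      refine absurd ((key (50 * q) (by ring)).2 p) ?_
      exact not_isSoluble_padic_of_dvd_left (c := 2 * ((p : ℤ) * q)) (c' := 50 * q) ⟨2 * q, by ring⟩
        (by rw [show (2 * ((p : ℤ) * q)) = p * (2 * q) by ring]; exact hnd _ (fun h => (hpI.dvd_or_dvd h).elim hp2' hpq)) h50q
    · -- d = 5pq : dies at p
      refine absurd ((key (20 * q) (by ring)).2 p) ?_
      exact not_isSoluble_padic_of_dvd_left (c := 5 * ((p : ℤ) * q)) (c' := 20 * q) ⟨5 * q, by ring⟩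
        (by rw [show (5 * ((p : ℤ) * q)) = p * (5 * q) by ring]; exact hnd _ (fun h => (hpI.dvd_or_dvd h).elim hp5' hpq)) h20q
    · -- d = 10pq : dies at p
      refine absurd ((key (10 * q) (by ring)).2 p) ?_
      exact not_isSoluble_padic_of_dvd_left (c := 2 * 5 * ((p : ℤ) * q)) (c' := 10 * q) ⟨2 * 5 * q, by ring⟩
        (by rw [show (2 * 5 * ((p : ℤ) * q)) = p * (10 * q) by ring]; exact hnd _ (hnd' 10 (Or.inr (Or.inr (Or.inr rfl))))) h10q
  · rintro (rfl | rfl)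
    · exact one_mem_twoIsogenySelmerGroup 0 hb
    · refine mem_twoIsogenySelmerGroup_of_isSquare hb (Int.squarefree_natCast.mpr hP.prime.squarefree) ⟨100 * q ^ 2, by ring⟩
        ⟨10 * q, ?_⟩
      rw [show (100 * p * q ^ 2 : ℤ) = (p : ℤ) * (100 * q ^ 2) by ring, Int.mul_ediv_cancel_left _ hp0]
      ring

end Dual

end Summit.BirchSwinnertonDyer.BirchSwinnertonDyer.Theorems.BiquadraticEisensteinDescentHeegnerTwistCouplingInSupplyQuarticTwistDescentDual

end
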